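import Mathlib
import Summits.ValiantsHypothesis.ValiantsHypothesis.Theorems.DivisionGapPerMultiplesHardStubFewRunsCount
import Summits.ValiantsHypothesis.ValiantsHypothesis.Theorems.DivisionGapPerMultiplesHardStubPermCounts
import Summits.ValiantsHypothesis.ValiantsHypothesis.Theorems.DivisionGapPerMultiplesHardStubSwapRepair

/-!
# `DivisionGap.PerMultiplesHard` (stmt-ValiantsHypothesis-5068), line `uncharged-face-walk`:
the ORDERED FACTOR, part 1 of 5 — vocabulary of orders and the counts over `Perm (Fin a)` (lead c8, cycle 8)

Setting (shared by the four `OrderedFactor*` files).  `X ⊆ Fin a × Fin a` is a bipartite block (rows `e.1`, columns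
`e.2`); `codeg X x x'` and `quad X x₁ x₂ x₃ x₄` are the 2- and 4-wise row intersections; an ORDER is `ρ ∈ Perm (Fin a)`
(position `k` carries row `ρ k`, its cyclic predecessor is `pre k = (finRotate a)⁻¹ k`); the SHIFTED INTERSECTION is
`shiftH X ρ = {(k, y) : (ρ k, y) ∈ X ∧ (ρ (pre k), y) ∈ X}` — its row degrees are consecutive codegrees (`rowdeg_shiftH`),
its row codegrees are 4-wise intersections (`codeg_shiftH`), its column degree at `y` counts the consecutive pairs of
the order inside the neighbourhood of `y` (`coldeg_shiftH`); a position is BAD if its consecutive codegree is `< t`;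
the NON-ADJACENT positions of `k` are those `∉ {k, pre k, suc k}`.  (All these notions are written out literally as
`Finset.filter` expressions — no definitions are introduced; `finRotate_symm_ne_self` is reused from `SwapRepair`.)
Content.  (i) `exists_good_index`: Markov ×3 plus a union bound (a potential `Σ statᵢ/(8(meanᵢ+1)) + #deficient`
of total `< card`).  (ii) `col_count`: for ONE column of degree `d ≥ a/D₁`, `4a·#{ρ : colW < a/(64D₁⁴)} ≤ a!` — the
event depends on the position set of the neighbourhood only (`stub_permCounts (3)`), few adjacencies are rare
(`stub_fewRunsCount`), and the binomial arithmetic is the hypothesis `harith` (supplied by `stub_columnRunsArith`).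
(iii) `sum_perm_pairs`, `sum_perm_quads`: `Σ_ρ Σ_k g(ρ k, ρ (pre k)) = a (a−2)! Σ_{x≠x'} g` and the 4-position
analogue over non-adjacent position pairs (`stub_permCounts (1), (2)`). Elementary. [folklore]
-/

noncomputable section

-- `Summit.ValiantsHypothesis.ValiantsHypothesis.…` is the tree's mandated layout (Sub = Summit).
set_option linter.dupNamespace false

open Finset
open scoped BigOperators

namespace Summit.ValiantsHypothesis.ValiantsHypothesis.Theorems.DivisionGap.PerMultiplesHard.OrderedFactor

/-! ### Vocabulary -/

variable {a : ℕ}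

/-- Auxiliary (codeg_le); see the module docstring. [folklore] -/
lemma codeg_le (X : Finset (Fin a × Fin a)) (x x' : Fin a) : ((Finset.univ.filter fun yy : Fin a => (x, yy) ∈ X ∧ (x', yy) ∈ X).card) ≤ a := by
  exact (Finset.card_filter_le _ _).trans (by simp)

/-- Auxiliary (quad_le); see the module docstring. [folklore] -/
lemma quad_le (X : Finset (Fin a × Fin a)) (x₁ x₂ x₃ x₄ : Fin a) : ((Finset.univ.filter fun yy : Fin a => (x₁, yy) ∈ X ∧ (x₂, yy) ∈ X ∧ (x₃, yy) ∈ X ∧ (x₄, yy) ∈ X).card) ≤ a := by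
  exact (Finset.card_filter_le _ _).trans (by simp)

/-- Auxiliary (colW_le); see the module docstring. [folklore] -/
lemma colW_le (X : Finset (Fin a × Fin a)) (ρ : Equiv.Perm (Fin a)) (y : Fin a) : ((Finset.univ.filter fun kk : Fin a => (ρ kk, y) ∈ X ∧ (ρ ((finRotate a).symm kk), y) ∈ X).card) ≤ a := by
  exact (Finset.card_filter_le _ _).trans (by simp)

/-- Auxiliary (pre_injective); see the module docstring. [folklore] -/
lemma pre_injective : Function.Injective (fun k : Fin a => (finRotate a).symm k) := by
  intro k k' h
  have := congrArg (finRotate a) h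
  rwa [Equiv.apply_symm_apply, Equiv.apply_symm_apply] at this

/-- Row degree of `H_ρ` at position `k` is the consecutive codegree. -/
lemma rowdeg_shiftH (X : Finset (Fin a × Fin a)) (ρ : Equiv.Perm (Fin a)) (k : Fin a) :
    (Finset.univ.filter fun y : Fin a => (k, y) ∈ (Finset.univ.filter fun ee : Fin a × Fin a => (ρ ee.1, ee.2) ∈ X ∧ (ρ ((finRotate a).symm ee.1), ee.2) ∈ X)).card = ((Finset.univ.filter fun yy : Fin a => ((ρ k), yy) ∈ X ∧ ((ρ (((finRotate a).symm k))), yy) ∈ X).card) := by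
  congr 1
  ext y
  simp

/-- Column degree of `H_ρ` is `colW`. -/
lemma coldeg_shiftH (X : Finset (Fin a × Fin a)) (ρ : Equiv.Perm (Fin a)) (y : Fin a) :
    (Finset.univ.filter fun k : Fin a => (k, y) ∈ (Finset.univ.filter fun ee : Fin a × Fin a => (ρ ee.1, ee.2) ∈ X ∧ (ρ ((finRotate a).symm ee.1), ee.2) ∈ X)).card = ((Finset.univ.filter fun kk : Fin a => (ρ kk, y) ∈ X ∧ (ρ ((finRotate a).symm kk), y) ∈ X).card) := by
  congr 1
  ext k
  simp

/-- Row codegree of `H_ρ` is the 4-wise intersection. -/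
lemma codeg_shiftH (X : Finset (Fin a × Fin a)) (ρ : Equiv.Perm (Fin a)) (k k' : Fin a) :
    (Finset.univ.filter fun y : Fin a => (k, y) ∈ (Finset.univ.filter fun ee : Fin a × Fin a => (ρ ee.1, ee.2) ∈ X ∧ (ρ ((finRotate a).symm ee.1), ee.2) ∈ X) ∧ (k', y) ∈ (Finset.univ.filter fun ee : Fin a × Fin a => (ρ ee.1, ee.2) ∈ X ∧ (ρ ((finRotate a).symm ee.1), ee.2) ∈ X)).card =
      ((Finset.univ.filter fun yy : Fin a => ((ρ k), yy) ∈ X ∧ ((ρ (((finRotate a).symm k))), yy) ∈ X ∧ ((ρ k'), yy) ∈ X ∧ ((ρ (((finRotate a).symm k'))), yy) ∈ X).card) := by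
  congr 1
  ext y
  simp [and_assoc]


/-! ### Generic first-moment selection -/

/-- Markov ×3 plus a union bound: some index has all three real statistics below `8·(mean + 1)` and the
fourth (natural) statistic equal to zero. -/
lemma exists_good_index {ι : Type*} [Fintype ι] [Nonempty ι] (f₁ f₂ f₃ : ι → ℝ) (f₄ : ι → ℕ)
    (h₁ : ∀ i, 0 ≤ f₁ i) (h₂ : ∀ i, 0 ≤ f₂ i) (h₃ : ∀ i, 0 ≤ f₃ i)
    (h₄ : 4 * ∑ i, f₄ i ≤ Fintype.card ι) :
    ∃ i, f₁ i < 8 * ((∑ j, f₁ j) / Fintype.card ι + 1) ∧ f₂ i < 8 * ((∑ j, f₂ j) / Fintype.card ι + 1) ∧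
      f₃ i < 8 * ((∑ j, f₃ j) / Fintype.card ι + 1) ∧ f₄ i = 0 := by
  set n : ℝ := (Fintype.card ι : ℝ) with hn
  have hnpos : 0 < n := by rw [hn]; exact_mod_cast Fintype.card_pos
  set M₁ : ℝ := (∑ j, f₁ j) / n + 1 with hM₁
  set M₂ : ℝ := (∑ j, f₂ j) / n + 1 with hM₂
  set M₃ : ℝ := (∑ j, f₃ j) / n + 1 with hM₃
  have hS₁ : 0 ≤ ∑ j, f₁ j := Finset.sum_nonneg fun j _ => h₁ j
  have hS₂ : 0 ≤ ∑ j, f₂ j := Finset.sum_nonneg fun j _ => h₂ j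
  have hS₃ : 0 ≤ ∑ j, f₃ j := Finset.sum_nonneg fun j _ => h₃ j
  have hM₁pos : 0 < M₁ := by rw [hM₁]; positivity
  have hM₂pos : 0 < M₂ := by rw [hM₂]; positivity
  have hM₃pos : 0 < M₃ := by rw [hM₃]; positivity
  -- key: Σ f / (8 M) ≤ n / 8
  have key : ∀ (S M : ℝ), 0 ≤ S → M = S / n + 1 → S / (8 * M) ≤ n / 8 := by
    intro S M hS hM
    have hMpos : 0 < M := by rw [hM]; positivity
    rw [div_le_div_iff₀ (by positivity) (by norm_num), hM]
    have : S * 8 ≤ (S / n + 1) * 8 * n := by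
      have h1 : (S / n + 1) * n = S + n := by field_simp
      nlinarith
    nlinarith
  let Φ : ι → ℝ := fun i => f₁ i / (8 * M₁) + f₂ i / (8 * M₂) + f₃ i / (8 * M₃) + (f₄ i : ℝ)
  have hΦsum : ∑ i, Φ i < ∑ _i : ι, (1 : ℝ) := by
    simp only [Φ, Finset.sum_add_distrib, Finset.sum_const, Finset.card_univ, nsmul_eq_mul, mul_one]
    rw [← Finset.sum_div, ← Finset.sum_div, ← Finset.sum_div]
    have e₁ := key _ _ hS₁ hM₁
    have e₂ := key _ _ hS₂ hM₂
    have e₃ := key _ _ hS₃ hM₃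
    have e₄ : (∑ i, (f₄ i : ℝ)) ≤ n / 4 := by
      have : (4 : ℝ) * ∑ i, (f₄ i : ℝ) ≤ n := by rw [hn]; exact_mod_cast h₄
      linarith
    rw [← hn]
    linarith
  obtain ⟨i, -, hi⟩ := Finset.exists_lt_of_sum_lt hΦsum
  have hΦi : Φ i = f₁ i / (8 * M₁) + f₂ i / (8 * M₂) + f₃ i / (8 * M₃) + (f₄ i : ℝ) := rfl
  rw [hΦi] at hi
  have t₁ : 0 ≤ f₁ i / (8 * M₁) := by have := h₁ i; positivity
  have t₂ : 0 ≤ f₂ i / (8 * M₂) := by have := h₂ i; positivity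
  have t₃ : 0 ≤ f₃ i / (8 * M₃) := by have := h₃ i; positivity
  have t₄ : (0 : ℝ) ≤ f₄ i := by positivity
  refine ⟨i, ?_, ?_, ?_, ?_⟩
  · have : f₁ i / (8 * M₁) < 1 := by linarith
    rwa [div_lt_one (by positivity)] at this
  · have : f₂ i / (8 * M₂) < 1 := by linarith
    rwa [div_lt_one (by positivity)] at this
  · have : f₃ i / (8 * M₃) < 1 := by linarith
    rwa [div_lt_one (by positivity)] at this
  · have : (f₄ i : ℝ) < 1 := by linarith
    have : f₄ i < 1 := by exact_mod_cast this
    omega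

/-! ### The column count -/

/-- For one column `y` of degree `d ≥ a/D₁`: at most `a!/(4a)` orders give it fewer than `a/(64 D₁⁴)` consecutive pairs. -/
lemma col_count (X : Finset (Fin a × Fin a)) (D₁ a₀ : ℕ)
    (harith : ∀ a' ≥ a₀, ∀ d : ℕ, a' ≤ D₁ * d → d ≤ a' →
      4 * a' * (∑ w' ∈ Finset.range (a' / (64 * D₁ ^ 4)), a'.choose w' * (a' + 1 - (d - w')).choose (d - w')) ≤
        a'.choose d)
    (ha : a₀ ≤ a) (y : Fin a) (hcol : a ≤ D₁ * (Finset.univ.filter fun x : Fin a => (x, y) ∈ X).card) :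
    4 * a * ((Finset.univ : Finset (Equiv.Perm (Fin a))).filter
      (fun ρ => ((Finset.univ.filter fun kk : Fin a => (ρ kk, y) ∈ X ∧ (ρ ((finRotate a).symm kk), y) ∈ X).card) < a / (64 * D₁ ^ 4))).card ≤ a.factorial := by
  classical
  set w := a / (64 * D₁ ^ 4) with hw
  set N : Finset (Fin a) := Finset.univ.filter fun x : Fin a => (x, y) ∈ X with hN
  set d := N.card with hd
  set 𝒬 : Finset (Finset (Fin a)) :=
    Finset.univ.filter fun S : Finset (Fin a) => (S.filter fun k => (finRotate a).symm k ∈ S).card < w with h𝒬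
  -- step 1: rewrite the event
  have h1 : ((Finset.univ : Finset (Equiv.Perm (Fin a))).filter (fun ρ => ((Finset.univ.filter fun kk : Fin a => (ρ kk, y) ∈ X ∧ (ρ ((finRotate a).symm kk), y) ∈ X).card) < w)) =
      (Finset.univ : Finset (Equiv.Perm (Fin a))).filter
        (fun ρ => (Finset.univ.filter fun k : Fin a => ρ k ∈ N) ∈ 𝒬) := by
    apply Finset.filter_congr
    intro ρ _
    have hc : ((Finset.univ.filter fun kk : Fin a => (ρ kk, y) ∈ X ∧ (ρ ((finRotate a).symm kk), y) ∈ X).card) =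
        ((Finset.univ.filter fun k : Fin a => ρ k ∈ N).filter
          fun k => (finRotate a).symm k ∈ (Finset.univ.filter fun k : Fin a => ρ k ∈ N)).card := by
      congr 1
      ext k
      simp [hN]
    simp only [h𝒬, Finset.mem_filter, Finset.mem_univ, true_and, hc]
  rw [h1, PermCounts.stub_permCounts.2.2 a N 𝒬]
  -- step 2: the set count
  have h2 : (𝒬.filter fun S => S.card = N.card).card ≤
      ∑ w' ∈ Finset.range w, a.choose w' * (a + 1 - (d - w')).choose (d - w') := by
    have : (𝒬.filter fun S => S.card = N.card) = (Finset.univ : Finset (Finset (Fin a))).filter (fun S =>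
        S.card = d ∧ (S.filter fun k => (finRotate a).symm k ∈ S).card < w) := by
      ext S; simp [h𝒬, hd, and_comm]
    rw [this]
    exact FewRunsCount.stub_fewRunsCount a d w
  have hda : d ≤ a := by rw [hd, hN]; exact (Finset.card_filter_le _ _).trans (by simp)
  have h3 := harith a ha d (by rw [hd, hN]; exact hcol) hda
  have h4 : a.choose d * d.factorial * (a - d).factorial = a.factorial :=
    Nat.choose_mul_factorial_mul_factorial hda
  calc 4 * a * ((𝒬.filter fun S => S.card = N.card).card * N.card.factorial * (a - N.card).factorial)
      = (4 * a * (𝒬.filter fun S => S.card = N.card).card) * d.factorial * (a - d).factorial := by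
        rw [hd]; ring
    _ ≤ (4 * a * ∑ w' ∈ Finset.range w, a.choose w' * (a + 1 - (d - w')).choose (d - w')) *
          d.factorial * (a - d).factorial := by gcongr
    _ ≤ a.choose d * d.factorial * (a - d).factorial := by gcongr
    _ = a.factorial := h4


/-! ### Sums over all orders -/

/-- Auxiliary (mem_nonAdj); see the module docstring. [folklore] -/
lemma mem_nonAdj {k k' : Fin a} : k' ∈ (((Finset.univ.erase k).erase ((finRotate a).symm k)).erase (finRotate a k)) ↔ k' ≠ finRotate a k ∧ k' ≠ ((finRotate a).symm k) ∧ k' ≠ k := by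
  simp [Finset.mem_erase]

/-- Auxiliary (card_nonAdj_le); see the module docstring. [folklore] -/
lemma card_nonAdj_le (k : Fin a) : ((((Finset.univ.erase k).erase ((finRotate a).symm k)).erase (finRotate a k))).card ≤ a := by
  exact (Finset.card_le_card (Finset.erase_subset _ _ |>.trans (Finset.erase_subset _ _)
    |>.trans (Finset.erase_subset _ _))).trans (by simp)

/-- Auxiliary (sum_perm_pairs); see the module docstring. [folklore] -/
lemma sum_perm_pairs (ha : 2 ≤ a) (g : Fin a → Fin a → ℝ) :
    ∑ ρ : Equiv.Perm (Fin a), ∑ k : Fin a, g (ρ k) (ρ (((finRotate a).symm k))) =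
      (a : ℝ) * ((a - 2).factorial : ℝ) * ∑ x : Fin a, ∑ x' ∈ Finset.univ.erase x, g x x' := by
  rw [Finset.sum_comm]
  have : ∀ k : Fin a, ∑ ρ : Equiv.Perm (Fin a), g (ρ k) (ρ (((finRotate a).symm k))) =
      ((a - 2).factorial : ℝ) * ∑ x : Fin a, ∑ x' ∈ Finset.univ.erase x, g x x' :=
    fun k => PermCounts.stub_permCounts.1 a k (((finRotate a).symm k)) (SwapRepair.finRotate_symm_ne_self ha k).symm g
  simp only [this, Finset.sum_const, Finset.card_univ, Fintype.card_fin, nsmul_eq_mul]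
  ring

/-- Auxiliary (sum_perm_quads); see the module docstring. [folklore] -/
lemma sum_perm_quads (ha : 2 ≤ a) (g : Fin a → Fin a → Fin a → Fin a → ℝ) :
    ∑ ρ : Equiv.Perm (Fin a), ∑ k : Fin a, ∑ k' ∈ (((Finset.univ.erase k).erase ((finRotate a).symm k)).erase (finRotate a k)), g (ρ k) (ρ (((finRotate a).symm k))) (ρ k') (ρ (((finRotate a).symm k'))) =
      (∑ k : Fin a, (((((Finset.univ.erase k).erase ((finRotate a).symm k)).erase (finRotate a k))).card : ℝ)) * ((a - 4).factorial : ℝ) *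
        ∑ x₁ : Fin a, ∑ x₂ ∈ Finset.univ.erase x₁, ∑ x₃ ∈ (Finset.univ.erase x₁).erase x₂,
          ∑ x₄ ∈ ((Finset.univ.erase x₁).erase x₂).erase x₃, g x₁ x₂ x₃ x₄ := by
  rw [Finset.sum_comm]
  have inner : ∀ k : Fin a, ∀ k' ∈ (((Finset.univ.erase k).erase ((finRotate a).symm k)).erase (finRotate a k)),
      ∑ ρ : Equiv.Perm (Fin a), g (ρ k) (ρ (((finRotate a).symm k))) (ρ k') (ρ (((finRotate a).symm k'))) =
        ((a - 4).factorial : ℝ) *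
          ∑ x₁ : Fin a, ∑ x₂ ∈ Finset.univ.erase x₁, ∑ x₃ ∈ (Finset.univ.erase x₁).erase x₂,
            ∑ x₄ ∈ ((Finset.univ.erase x₁).erase x₂).erase x₃, g x₁ x₂ x₃ x₄ := by
    intro k k' hk'
    rw [mem_nonAdj] at hk'
    obtain ⟨h1, h2, h3⟩ := hk'
    refine PermCounts.stub_permCounts.2.1 a k (((finRotate a).symm k)) k' (((finRotate a).symm k')) (SwapRepair.finRotate_symm_ne_self ha k).symm (Ne.symm h3) ?_ (Ne.symm h2) ?_
      (SwapRepair.finRotate_symm_ne_self ha k').symm g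
    · intro h; apply h1; rw [h, Equiv.apply_symm_apply]
    · intro h; exact h3 (pre_injective h).symm
  have : ∀ k : Fin a, ∑ k' ∈ (((Finset.univ.erase k).erase ((finRotate a).symm k)).erase (finRotate a k)), ∑ ρ : Equiv.Perm (Fin a), g (ρ k) (ρ (((finRotate a).symm k))) (ρ k') (ρ (((finRotate a).symm k'))) =
      (((((Finset.univ.erase k).erase ((finRotate a).symm k)).erase (finRotate a k))).card : ℝ) * (((a - 4).factorial : ℝ) *
          ∑ x₁ : Fin a, ∑ x₂ ∈ Finset.univ.erase x₁, ∑ x₃ ∈ (Finset.univ.erase x₁).erase x₂,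
            ∑ x₄ ∈ ((Finset.univ.erase x₁).erase x₂).erase x₃, g x₁ x₂ x₃ x₄) := by
    intro k
    rw [Finset.sum_congr rfl (inner k), Finset.sum_const, nsmul_eq_mul]
  have step : ∀ k : Fin a,
      ∑ ρ : Equiv.Perm (Fin a), ∑ k' ∈ (((Finset.univ.erase k).erase ((finRotate a).symm k)).erase (finRotate a k)), g (ρ k) (ρ (((finRotate a).symm k))) (ρ k') (ρ (((finRotate a).symm k'))) =
        ∑ k' ∈ (((Finset.univ.erase k).erase ((finRotate a).symm k)).erase (finRotate a k)), ∑ ρ : Equiv.Perm (Fin a), g (ρ k) (ρ (((finRotate a).symm k))) (ρ k') (ρ (((finRotate a).symm k'))) :=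
    fun k => Finset.sum_comm
  rw [Finset.sum_congr rfl (fun k _ => (step k).trans (this k)), ← Finset.sum_mul]
  ring

/-- **Registered form of `sum_perm_pairs` (ordered factor, part 1).**  Summing a weight of the consecutive value pair
`(ρ k, ρ (k−1))` over all positions and all orders counts every ordered pair of distinct values `a·(a−2)!` times. [folklore] -/
theorem orderedFactor_sumPairs :
    ∀ (a : ℕ), 2 ≤ a → ∀ g : Fin a → Fin a → ℝ, ∑ ρ : Equiv.Perm (Fin a), ∑ k : Fin a, g (ρ k) (ρ ((finRotate a).symm k)) = (a : ℝ) * ((a - 2).factorial : ℝ) * ∑ x : Fin a, ∑ x' ∈ Finset.univ.erase x, g x x' :=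
  fun _a ha g => sum_perm_pairs ha g

end Summit.ValiantsHypothesis.ValiantsHypothesis.Theorems.DivisionGap.PerMultiplesHard.OrderedFactor

end
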